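import Literature.Geometry.Lorentzian.AFEndRestrict
import Mathlib.Analysis.Normed.Module.Connected
import HarnessLib

/-!
# A sole asymptotically flat end is the same end as every end structure

Topic `Geometry/Lorentzian`; everything here is PROVED (no named facts). For an end structure
`e : AFEnd X` of the `3`-manifold `X` (`AsymptoticFlatness.lean`) which is SOLE (`AFEnd.IsSoleEnd`:
some far region has compact complement) and ANY end structure `e'` of `X`, the two structures
describe the same end, `AFEnd.IsSameEnd e e'` (each far region of one contains a far region of the
other) — the hypothesis of Bartnik's uniqueness theorem (`HasADMEnergy.Of_isSameEnd`, Bartnik 1986,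
Cor. 3.2 / Thm. 4.2) and of Chruściel's covariance (`chrusciel1986_admMomentum_chartCovariance`).
Proof: (i) far regions of `e'` eventually miss the compact complement of a far region of `e`
(`AFEnd.exists_forall_far_disjoint`); (ii) a far region of `e` missing the compact coordinate
sphere `{‖coord'‖ = R₃}` of `e'` is preconnected (image of `{R < ‖x‖} ⊂ ℝ³`), hence lies inside
`e'.far R₃` or inside the complement of the closed far set `{R₃ ≤ ‖coord'‖}`; the latter would make
that closed far set compact, which far regions of `e'` (nonempty, eventually missing every compact
set) forbid. No Jordan–Brouwer is needed.

Main statements: `AFEnd.IsSoleEnd.exists_far_subset_far`, `AFEnd.IsSoleEnd.exists_far_subset_far'`,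
`AFEnd.IsSoleEnd.isSameEnd`. The topological helpers (far regions preconnected and nonempty) are
PRIVATE copies: the public statements are `AFEnd.isPreconnected_far`
(`ExteriorRegionSchwarzschildEnd`) and `AFEnd.far_nonempty` (`ConformalScalarFlatCore`), whose heavy
import closures (capacity / conformal-PMT files) this elementary file deliberately avoids — the same
device as `StationaryBlackHoleUniquenessProofs`'s private `AFEnd_isPreconnected_far_aux`. Sources: Bartnik, CPAM 39 (1986), §1 and §3 (structures of infinity,
Cor. 3.2); Schoen–Yau 1979 (one-ended complete manifolds). [cite: Bartnik1986, §3, Cor. 3.2]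
(decomp-fsc lens-5 g8, bridge B1 of node «FarDoorClosing».)
-/

open scoped Topology Manifold ContDiff
open Set

namespace Literature.Geometry.Lorentzian

namespace AFEnd

variable {X : Type} [TopologicalSpace X] [ChartedSpace E3 X]  -- universe 0, as in `AFEndRestrict` / `AsymptoticallyFlatChart`

/-- `{x : ℝ³ | R' < ‖x‖}` is preconnected for `R' ≥ 0` (image of `S² × (R', ∞)` under `(y, t) ↦ t • y`);
private copy, cf. `isPreconnected_exteriorRegion_normGt`. [folklore] -/
private theorem isPreconnected_normGt_aux {R' : ℝ} (hR' : 0 ≤ R') : IsPreconnected {x : E3 | R' < ‖x‖} := by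
  have h3 : 1 < Module.rank ℝ E3 := by
    rw [← Module.finrank_eq_rank, finrank_euclideanSpace_fin]
    norm_num
  have hS : IsPreconnected (Metric.sphere (0 : E3) 1 ×ˢ Set.Ioi R') :=
    (isPreconnected_sphere h3 (0 : E3) 1).prod isPreconnected_Ioi
  have hc : Continuous fun p : E3 × ℝ ↦ p.2 • p.1 := continuous_snd.smul continuous_fst
  have himg := hS.image _ hc.continuousOn
  convert himg using 1
  ext x
  simp only [Set.mem_setOf_eq, Set.mem_image, Set.mem_prod, mem_sphere_iff_norm, sub_zero, Set.mem_Ioi,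
    Prod.exists]
  constructor
  · intro hx
    have hx0 : 0 < ‖x‖ := hR'.trans_lt hx
    refine ⟨‖x‖⁻¹ • x, ‖x‖, ⟨?_, hx⟩, ?_⟩
    · rw [norm_smul, norm_inv, norm_norm, inv_mul_cancel₀ hx0.ne']
    · rw [smul_smul, mul_inv_cancel₀ hx0.ne', one_smul]
  · rintro ⟨y, t, ⟨hy, ht⟩, rfl⟩
    rw [norm_smul, hy, mul_one, Real.norm_eq_abs, abs_of_pos (hR'.trans_lt ht)]
    exact ht

/-- A far region is the `dataChart`-image of a coordinate exterior region (private helper). [cite: Bartnik1986, §1] -/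
private theorem far_eq_image_dataChart_aux (e : AFEnd X) (R' : ℝ) :
    e.far R' = e.dataChart '' {z : exteriorRegion e.R | R' < ‖(z : E3)‖} := by
  ext q
  rw [e.mem_far_iff, Set.mem_image]
  rfl

/-- The inverse chart of an end is continuous (private helper; public: `contMDiff_dataChart`). [cite: Bartnik1986, §1] -/
private theorem continuous_dataChart_aux (e : AFEnd X) : Continuous e.dataChart :=
  continuous_subtype_val.comp e.chart.symm.continuous

/-- Far regions (beyond the inner radius) are preconnected — private copy of the public
`AFEnd.isPreconnected_far` of `ExteriorRegionSchwarzschildEnd` (not imported here, see the module docstring). [folklore] -/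
private theorem isPreconnected_far_aux (e : AFEnd X) {R' : ℝ} (hR' : e.R ≤ R') : IsPreconnected (e.far R') := by
  rw [far_eq_image_dataChart_aux]
  refine IsPreconnected.image ?_ _ (continuous_dataChart_aux e).continuousOn
  have hind : Topology.IsInducing ((↑) : exteriorRegion e.R → E3) := Topology.IsInducing.subtypeVal
  have hset : ((↑) : exteriorRegion e.R → E3) '' {z : exteriorRegion e.R | R' < ‖(z : E3)‖} = {x : E3 | R' < ‖x‖} := by
    ext x
    simp only [Set.mem_image, Set.mem_setOf_eq]
    constructor
    · rintro ⟨z, hz, rfl⟩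
      exact hz
    · intro hx
      exact ⟨⟨x, lt_of_le_of_lt hR' hx⟩, hx, rfl⟩
  have hpre : IsPreconnected (((↑) : exteriorRegion e.R → E3) '' {z : exteriorRegion e.R | R' < ‖(z : E3)‖}) := by
    rw [hset]
    exact isPreconnected_normGt_aux (e.R_pos.le.trans hR')
  exact hind.isPreconnected_image.1 hpre

/-- Far regions are nonempty — private copy of the public `AFEnd.far_nonempty` of `ConformalScalarFlatCore`
(not imported here, see the module docstring). [folklore] -/
private theorem far_nonempty_aux (e : AFEnd X) (R' : ℝ) : (e.far R').Nonempty := by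
  set t : ℝ := max R' e.R + 1 with ht
  have htR : e.R < t := by linarith [le_max_right R' e.R]
  have htR' : R' < t := by linarith [le_max_left R' e.R]
  have htpos : 0 < t := e.R_pos.trans htR
  have hu : ‖(EuclideanSpace.single (0 : Fin 3) (1 : ℝ) : E3)‖ = 1 := by simp
  have hnorm : ‖(t • EuclideanSpace.single (0 : Fin 3) (1 : ℝ) : E3)‖ = t := by
    rw [norm_smul, hu, mul_one, Real.norm_eq_abs, abs_of_pos htpos]
  refine ⟨e.dataChart ⟨t • EuclideanSpace.single (0 : Fin 3) (1 : ℝ), ?_⟩, ?_⟩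
  · show e.R < ‖t • EuclideanSpace.single (0 : Fin 3) (1 : ℝ)‖
    rw [hnorm]
    exact htR
  · rw [e.dataChart_mem_far_iff]
    show R' < ‖t • EuclideanSpace.single (0 : Fin 3) (1 : ℝ)‖
    rw [hnorm]
    exact htR'

/-- Half of B1: every far region of a SOLE end contains a far region of any other end structure. [cite: Bartnik1986, §1] [cite: SchoenYau1979] -/
theorem IsSoleEnd.exists_far_subset_far {e : AFEnd X} (h : e.IsSoleEnd) (e' : AFEnd X) (R₂ : ℝ) :
    ∃ R₁, e'.far R₁ ⊆ e.far R₂ := by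
  obtain ⟨R₀, hR₀⟩ := e'.exists_forall_far_disjoint (h.isCompact_compl_far R₂)
  exact ⟨R₀, Set.disjoint_compl_right_iff_subset.mp (hR₀ R₀ le_rfl)⟩

/-- Half of B1: every far region of ANY end structure contains a far region of a sole end (connectedness of the far
regions of the sole end + compactness of the coordinate spheres + closedness at infinity) — the cofinality of
Bartnik's structures of infinity, which are defined on the complement of a COMPACT set (§1), read for a sole end of
our `AFEnd`. [cite: Bartnik1986, §1] -/
theorem IsSoleEnd.exists_far_subset_far' {e : AFEnd X} (h : e.IsSoleEnd) (e' : AFEnd X) (R₂ : ℝ) :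
    ∃ R₁, e.far R₁ ⊆ e'.far R₂ := by
  -- enlarge `R₂` beyond the inner radius of `e'`
  obtain ⟨R₃, hR₂₃, hR₃⟩ : ∃ R₃, R₂ ≤ R₃ ∧ e'.R < R₃ :=
    ⟨max R₂ (e'.R + 1), le_max_left _ _, by linarith [le_max_right R₂ (e'.R + 1)]⟩
  suffices hs : ∃ R₁, e.far R₁ ⊆ e'.far R₃ by
    obtain ⟨R₁, h₁⟩ := hs
    exact ⟨R₁, h₁.trans (e'.far_mono hR₂₃)⟩
  -- the coordinate sphere of radius `R₃` of `e'`, a compact subset of `X`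
  set T : Set (exteriorRegion e'.R) := {z | ‖(z : E3)‖ = R₃} with hT
  set S : Set X := e'.dataChart '' T with hS
  have hTc : IsCompact T := by
    have hind : Topology.IsInducing ((↑) : exteriorRegion e'.R → E3) := Topology.IsInducing.subtypeVal
    have hTS : ((↑) : exteriorRegion e'.R → E3) '' T = Metric.sphere (0 : E3) R₃ := by
      ext x
      simp only [Set.mem_image, mem_sphere_iff_norm, sub_zero, hT, Set.mem_setOf_eq]
      constructor
      · rintro ⟨z, hz, rfl⟩
        exact hz
      · intro hx
        exact ⟨⟨x, show e'.R < ‖x‖ by rw [hx]; exact hR₃⟩, hx, rfl⟩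
    have hsph : IsCompact (((↑) : exteriorRegion e'.R → E3) '' T) := by
      rw [hTS]
      exact isCompact_sphere (0 : E3) R₃
    exact hind.isCompact_iff.2 hsph
  have hSc : IsCompact S := hTc.image (continuous_dataChart_aux e')
  -- the closed far set `C = {R₃ ≤ ‖coord‖}` of `e'` (closed at infinity) and `C ⊆ far R₃ ∪ S`, `far R₃ ⊆ C`
  set C : Set X := ((↑) : e'.U → X) '' (e'.chart ⁻¹' {x | R₃ ≤ ‖(x : E3)‖}) with hC
  have hCcl : IsClosed C := e'.isClosed_far R₃ hR₃
  have hCsub : C ⊆ e'.far R₃ ∪ S := by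
    rintro _ ⟨y, hy, rfl⟩
    rcases (show R₃ ≤ ‖(e'.chart y : E3)‖ from hy).lt_or_eq with hlt | heq
    · exact Or.inl ⟨y, hlt, rfl⟩
    · exact Or.inr ⟨e'.chart y, heq.symm, e'.dataChart_chart y⟩
  have hfarC : e'.far R₃ ⊆ C := by
    rintro _ ⟨y, hy, rfl⟩
    have hy' : R₃ < ‖(e'.chart y : E3)‖ := hy
    exact ⟨y, show R₃ ≤ ‖(e'.chart y : E3)‖ from hy'.le, rfl⟩
  -- a far region of the sole end `e` missing the compact sphere `S`
  obtain ⟨R₀, hR₀⟩ := e.exists_forall_far_disjoint hSc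
  refine ⟨max R₀ e.R, ?_⟩
  have hdisj : Disjoint (e.far (max R₀ e.R)) S := hR₀ _ (le_max_left _ _)
  have hcover : e.far (max R₀ e.R) ⊆ e'.far R₃ ∪ Cᶜ := by
    intro q hq
    by_cases hqC : q ∈ C
    · rcases hCsub hqC with h1 | h2
      · exact Or.inl h1
      · exact (Set.disjoint_left.1 hdisj hq h2).elim
    · exact Or.inr hqC
  have hdisj' : Disjoint (e'.far R₃) Cᶜ := Set.disjoint_compl_right_iff_subset.2 hfarC
  rcases (isPreconnected_far_aux e (le_max_right _ _)).subset_or_subset (e'.isOpen_far R₃) hCcl.isOpen_compl hdisj'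
      hcover with h1 | h2
  · exact h1
  · -- then `C` is compact (closed inside the compact complement of a far region of the sole end): absurd, since the
    -- far regions of `e'` inside `C` are nonempty but eventually miss every compact set
    exfalso
    have hCc : IsCompact C :=
      (h.isCompact_compl_far (max R₀ e.R)).of_isClosed_subset hCcl (Set.subset_compl_comm.1 h2)
    obtain ⟨R₄, hR₄⟩ := e'.exists_forall_far_disjoint hCc
    obtain ⟨q, hq⟩ := far_nonempty_aux e' (max R₄ R₃)
    exact Set.disjoint_left.1 (hR₄ (max R₄ R₃) (le_max_left _ _)) hq (hfarC (e'.far_mono (le_max_right _ _) hq))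

/-- **B1 (PROVED)**: a sole end structure describes the same end as every end structure of `X`
(`IsSoleEnd e → IsSameEnd e e'`). [cite: Bartnik1986, §3, Cor. 3.2] -/
theorem IsSoleEnd.isSameEnd {e : AFEnd X} (h : e.IsSoleEnd) (e' : AFEnd X) : e.IsSameEnd e' :=
  ⟨fun R₂ ↦ h.exists_far_subset_far' e' R₂, fun R₂ ↦ h.exists_far_subset_far e' R₂⟩

end AFEnd

end Literature.Geometry.Lorentzian
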